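import Literature.MathematicalPhysics.QuantumFieldTheory.Balaban1983to89.B13GreenCentreDecayOfCoercive
import Literature.MathematicalPhysics.QuantumFieldTheory.Balaban1983to89.B13OpsYPencilRProjSym
import Literature.MathematicalPhysics.QuantumFieldTheory.Balaban1983to89.B13XinvSymLettersOfReg335

/-!
# `Balaban1983to89.B13GreenSymLettersOfReg335` — T. Bałaban, *Propagators for lattice gauge theories in a background field*, Commun. Math. Phys. **99** (1985) 389–434
# [Balaban1985BackgroundPropagators], (3.19)–(3.27) pp. 393–395 (Q′, Δ′_a, G′, R, Δ_a, G), (3.35) p. 396, Thms 3.1–3.3 pp. 397–399, Thm 3.4 p. 400 and Sect. B (3.84)–(3.86) p. 407,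
# Thm 3.10 (3.107)–(3.108) pp. 415–416, Thm 3.11 p. 416, with [4] = [Balaban1984PropagatorsII] p. 226 and [Balaban1988RG2Cluster] (2.5)–(2.7) pp. 12–13:
# ★★★★ THE N06 → N10 KNIT FOR THE G FACTOR — PRINT's CHAIN `G′ → (Q′G′²Q′*)⁻¹ → R → Δ_a → G` AT NODE 00's v4 LETTERS OF RECORD ON THE (3.35) CLASS, END TO END, WITH THE
# N06-SIDE INPUT FOR THE LAST INVERSE = ROW 17's ONE CLAUSE AT `U₀`.

statement-level composition of cited tree theorems; kernel-checked; THEOREMS ONLY; nothing of NODE 00's ∕ N06's is modified; nothing here is a claim about the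
Yang–Mills mass gap; no node is discharged; count-neutral.

WHY THIS FILE (cell `pub-ymgap`, HUMAN RULING D-0062 ∕ D-0149, Track A node N10 = [B13]; width seat `pub-ymgap-dag-n10-w2` g3, CLAIM-5; the lane's census
`N10-RESIDUAL-CENSUS-v17.md` item 1 «the bond-sector twin of 79» and its word INBOX l.≈31382 «the v4 chain G′(79) → X⁻¹(81 + p613219 ∘ XQuadGen) → R(RProjSym) → Δ_a ∕ G
(Green + GreenCentre) is then named end to end, displaying on the N06 side ONLY the bond-sector `hco`»).  This file WRITES that end-to-end composition as ONE theorem at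
the letters of record `parSymY ∕ parBY ∕ GpY i (parSymY i)`, matrix-unit coordinates: G′ by dag-n10-c's module 79 (`B13GreenPrimeSymLettersOfReg335`: Theorem 3.1 and
`IsUnit (Δ′_a(U₀))` are N06's TREE theorems), R by `B13OpsYPencilRProjSym` §2, the local part of `Δ_a` by the lane's 76 §4, `D R D*` by n10-w2 g2's G-station §3, the
last inverse by `B13GreenCentreDecayOfCoercive` §6 (row 17's clause ⟹ coercivity by n06's `exists_pos_coer_of_posDefTr` ⟹ Combes–Thomas by module 80).  DISPLAYED analytic
inputs: (a) the X⁻¹-junction's output `hXi` (Theorem 3.2's content; `B13OpsYPencilXQuadGen` §4 at v4 + `B13XinvCentreDecayOf{Unitary,Reg335}` ∕ n10-w5's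
`B13XinvSymLettersOfReg335` supply it on (3.35)), (b) ROW 17's ONE CLAUSE `PosDefTr w (Δ_a(U₀))` (`B9Thm311PosAtRecordV4` §5 — Theorems 3.3 ∕ 3.11 for `Δ_a`, N06's).
Everything else: NODE 00's dictionary numerals and readings, radii and rates.
* §1 ★★★★ `exists_rawEntryLetters_toMatrix_GAY_recordV4_prodCfg_of_reg335_of_posDefTr` — for EVERY `U₀ ∈ (bg9K (M_N ℂ) G i).Reg335 c α₀`: (a) + (b) + numerals ⟹
  `∃ κ > 0, ∃ B_G ≥ 0, ∀ 0 ≤ ρ″ < κ, ∃ R₁ > 0, RawEntryLetters (A′ ↦ toMatrix B′ B′ (G(e^{iηA′}U₀))) (ℓF ∘ fst) R₁ ρ″ B_G` (QUALITATIVE rate on purpose: the clause's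
  coercivity constant is unlocated; the quantitative road is `B13GreenCentreDecayOfCoercive` §3–§5 with a located `m`); ★★★★ `…_of_posDefTr_one` (the same in
  row 17's own currency: flat weight, `hpd : PosDefTr (fun _ => 1) (deltaAY i (parSymY i) (parBY i) (GpY i (parSymY i)) U₀)` verbatim).
v1.1 (APPEND-ONLY; §1 byte-identical; import of n10-w5's `B13XinvSymLettersOfReg335` added): + §2 ★★★ A6 `exists_rawEntryLetters_toMatrix_GAY_recordV4_prodCfg_one` — AT THE
  UNIT BACKGROUND `U₀ = 1` every displayed analytic input of §1 is a TREE theorem (`reg335_one`; n10-w5's X⁻¹ knit on (3.35); dag-n06-j's `posDefTr_deltaAY_parSymY_one`),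
  so the v4 G-chain holds there with NO analytic hypothesis — the chain's binder architecture is jointly inhabited.
HONEST FRAMING: a composition; (a) and (b) DISPLAYED — Theorem 3.2's decay of `X⁻¹(U₀)` and Theorems 3.3 ∕ 3.11's positivity of `Δ_a(U₀)` on (3.35) are NOT proved here;
print's multi-scale rates `δ₀d(y,y′)` NOT claimed (rates per reading step, n06-w1's declared scope); nothing of Bałaban's asserted beyond the cited theorems; N06 ∕ N10 NOT
discharged; K1⁷ NOT closed; counts unmoved (typed 28∕28 · discharged 5∕27); 0 `def`, 0 `sorry`, standard axioms; one finite 𝕋⁴ programme at fixed ε — R4 closes the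
conditional finite-𝕋⁴ rung `BalabanLadder.UV` only; the YM mass gap (Clay) is NOT proved by any of this; nothing continuum ∕ ℝ⁴ ∕ OS.

References: T. Bałaban, CMP 99 (1985) 389–434 [Balaban1985BackgroundPropagators] (3.19)–(3.27) pp.393–395, (3.35) p.396, Thm 3.1 (3.42) p.397, Thm 3.2 (3.48) p.398,
Thm 3.3 p.399, Thm 3.4 p.400, (3.60)–(3.65) p.402, (3.66)–(3.68) p.403, (3.69)–(3.70) p.404, (3.71)–(3.72) p.405, (3.84)–(3.86) p.407, Thm 3.10 (3.107)–(3.108) pp.415–416, Thm 3.11 p.416; CMP 96 (1984) 223–250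
[Balaban1984PropagatorsII] (2.19) and p.226, Lemma 2.1 (2.61) p.234; CMP 116 (1988) 1–22 [Balaban1988RG2Cluster] (2.5)–(2.7) pp.12–13, p.15; M. Aizenman, S. Warzel,
*Random Operators* (AMS 2015) §10.3 [AizenmanWarzel2015].
DOC-ONLY EDITION (dag-n10-w2 g4, 2026-08-28): [B9] page locators corrected per the page owner lit-balaban-r06 — (3.25) p.394; (3.48) p.398; (3.60)–(3.65) p.402,
(3.66)–(3.68) p.403, (3.69)–(3.70) p.404, (3.71)–(3.72) p.405; (3.84)–(3.86) p.407 only; every declaration byte-identical to the previous edition.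
-/

noncomputable section

namespace Literature.MathematicalPhysics.QuantumFieldTheory.Balaban1983to89.B13GreenSymLettersOfReg335

open Metric Set Finset Module
open scoped Matrix Matrix.Norms.L2Operator
open Literature.MathematicalPhysics.QuantumFieldTheory.Balaban1983to89
open Literature.MathematicalPhysics.QuantumFieldTheory.Balaban1983to89.B9Thm37GlueTorus (tdist1)
open Literature.MathematicalPhysics.QuantumFieldTheory.Balaban1983to89.B5TorusCover (UT)
open Literature.MathematicalPhysics.QuantumFieldTheory.Balaban1983to89.B4TorusKernel.MultiPeriod (torusSupNorm)
open Literature.MathematicalPhysics.QuantumFieldTheory.Balaban1983to89.B9Thm311ReadingCoords (trIP PosDefTr)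
open Literature.MathematicalPhysics.QuantumFieldTheory.Balaban1983to89.B13EntrywiseWalks (RawEntryLetters)
open Literature.MathematicalPhysics.QuantumFieldTheory.Balaban1983to89.B13MatrixUnitBasisNumerals (norm_stdBasis_repr_le norm_stdBasis_le_one)
open Literature.MathematicalPhysics.QuantumFieldTheory.Balaban1983to89.B13OpsYPencilGreen (rawEntryLetters_toMatrix_deltaAY_prodCfg)
open Literature.MathematicalPhysics.QuantumFieldTheory.Balaban1983to89.B13OpsYPencilDeltaALetters (rawEntryLetters_toMatrix_localDeltaA_prodCfg)
open Literature.MathematicalPhysics.QuantumFieldTheory.Balaban1983to89.B13OpsYPencilRProjSym (rawEntryLetters_toMatrix_RY_parSymY_prodCfg_of_reg335_record)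
open Literature.MathematicalPhysics.QuantumFieldTheory.Balaban1983to89.B13GreenPrimeSymLettersOfReg335 (norm_unit_le_one_of_mem)
open Literature.MathematicalPhysics.QuantumFieldTheory.Balaban1983to89.B13GreenCentreDecayOfCoercive (exists_rawEntryLetters_toMatrix_GAY_prodCfg_of_posDefTr)
open Literature.MathematicalPhysics.QuantumFieldTheory.Balaban1983to89.B15DeterminingSets (embIter)
open Literature.MathematicalPhysics.QuantumFieldTheory.Balaban1983to89.B9Eq39Adjoint (prodCfg)
open Literature.MathematicalPhysics.QuantumFieldTheory.Balaban1983to89.B6GlobalChartV1 (PV boxEquiv)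
open Literature.MathematicalPhysics.QuantumFieldTheory.Balaban1983to89.B6KLevelCensusIndexV1 (KIdx kGeo)
open Literature.MathematicalPhysics.QuantumFieldTheory.Balaban1983to89.B9BackgroundsKLevelV1 (bg9K)
open Literature.MathematicalPhysics.QuantumFieldTheory.Balaban1983to89.B9BackgroundsKLevelV1 (reg335_one eta_pos_L_one_le_M_pos)
open Literature.MathematicalPhysics.QuantumFieldTheory.Balaban1983to89.B13XinvSymLettersOfReg335 (rawEntryLetters_toMatrix_XinvY_parSymY_prodCfg_of_reg335)
open Literature.MathematicalPhysics.QuantumFieldTheory.Balaban1983to89.B9Thm311PosAtRecordV4 (posDefTr_deltaAY_parSymY_one)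
open Literature.MathematicalPhysics.QuantumFieldTheory.Balaban1983to89.B13InverseLettersNeumannRadius (thinRadius_pos)
open Literature.MathematicalPhysics.QuantumFieldTheory.Balaban1983to89.B13EntryLetterAlgebra (rawEntryLetters_mono)
open Literature.MathematicalPhysics.QuantumFieldTheory.Balaban1983to89.NodeOLettersSqrtExpDecay (exists_uniform_rate)
open Literature.MathematicalPhysics.QuantumFieldTheory.Balaban1983to89.B6RandomWalk (c0_nonneg)
open Literature.MathematicalPhysics.QuantumFieldTheory.Balaban1983to89.Node00

/-! ## §1. ★★★★ The whole chain at the v4 letters of record on the (3.35) class: `G(e^{iηA′}U₀)` from row 17's ONE clause at `U₀` and X⁻¹'s pencil letters -/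

section Chain

variable {d ℓ : ℕ} {hd : 1 ≤ d + 1} {hL : Odd (ℓ + 1) ∧ 1 < ℓ + 1} {b₀ b₁ : ℝ}
variable (i : KIdx d ℓ hd hL b₀ b₁) {N : ℕ} [NeZero N] {G : Subgroup (Matrix (Fin N) (Fin N) ℂ)ˣ}
variable {ν : ℕ} {Nf : Fin ν → ℕ} [∀ j, NeZero (Nf j)]

/-- ★★★★ **PRINT's CHAIN `G′ → (Q′G′²Q′*)⁻¹ → R → Δ_a → G` AT NODE 00's v4 LETTERS OF RECORD ON THE (3.35) CLASS, END TO END, N06-SIDE INPUT = ROW 17's ONE CLAUSE.**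
For EVERY background `U₀ ∈ (bg9K (M_N ℂ) G i).Reg335 c α₀` (`G ≤ U(N)`, `0 ≤ c·M·α₀`, `c·M·α₀·(d+1) ≤ 1∕16`), at `parS := parSymY i`, `parB := parBY i`, `G′ := GpY i (parSymY i)`,
matrix-unit coordinates: the G′ factor is dag-n10-c's module 79 (Theorem 3.1 + invertibility of `Δ′_a` = N06's TREE theorems), the R-station is `B13OpsYPencilRProjSym` §2,
the local part of `Δ_a` is the lane's 76 §4, the `D R D*` assembly is n10-w2 g2's G-station §3, and the last inverse is `B13GreenCentreDecayOfCoercive` §6 — so the ONLY analytic inputs displayed are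
(a) the X⁻¹-junction's output `hXi : RawEntryLetters (A′ ↦ toMatrix (X⁻¹(e^{iηA′}U₀))) (ℓB ∘ fst) R′ ρ_X B_X` (Theorem 3.2's content — `B13OpsYPencilXQuadGen` §4 +
`B13XinvCentreDecayOf{Unitary,Reg335}` ∕ n10-w5's `…XinvSymLettersOfReg335` discharge it on (3.35)) and (b) ROW 17's ONE CLAUSE AT `U₀`: `hpd : PosDefTr w (Δ_a(U₀))`
(`B9Thm311PosAtRecordV4` §5's located residual = Theorems 3.3 ∕ 3.11 for `Δ_a` — N06's).  Everything else is NODE 00's dictionary numerals and readings (79's `D, Cavg, ℓ′, s,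
κ, m`; the R-station's `D_Q, CQsr, CQc, ℓB, r`; 76's `c₁ c₂ N_b D_a c_Q c_{Q*} c_a`, bond reading `ℓF` with `s_F`; the G-station's `CgR CdC r′`, fibre `m_F`), `η`, `0 < Rc`,
a radius `0 < R′ ≤ R₁⋆(79)`, rates `0 ≤ ρ′ < δ₀κ`, `0 ≤ ρ_X ≤ ρ′`, `0 < μ`, `2μ < ρ_X`, and the weight `w > 0` with ratio numeral `Θ ≥ 0`.  Conclusion (qualitative rate, on
purpose — the unlocated coercivity constant of the clause sets it): `∃ κ > 0, ∃ B_G ≥ 0, ∀ 0 ≤ ρ″ < κ, ∃ R₁ > 0, RawEntryLetters (A′ ↦ toMatrix B′ B′ (G(e^{iηA′}U₀))) (ℓF ∘ fst) R₁ ρ″ B_G`.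
(b) IS THE QUALITATIVE POSITIVITY: the constant `m` extracted from it by compactness (n06's `exists_pos_coer_of_posDefTr`) is a finite-lattice number, NOT located — print's
uniform `γ₀` of Thm 3.3 ∕ [4] (2.22) is the quantitative `hco` the lane's LOCATED-ASK (INBOX l.30423) asks N06 for; when it lands, an edition with `m` explicit through
`B13GreenCentreDecayOfCoercive` §3–§5 is the natural successor.
[cite: Balaban1985BackgroundPropagators, (3.19)–(3.27) pp.393–395, (3.35) p.396, Thm 3.1 (3.42) p.397, Thm 3.2 (3.48) p.398, Thm 3.3 p.399, Thm 3.4 p.400, (3.60)–(3.65) p.402,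
(3.66)–(3.68) p.403, (3.69)–(3.70) p.404, (3.71)–(3.72) p.405, (3.84)–(3.86) p.407, Thm 3.10 (3.107)–(3.108) pp.415–416, Thm 3.11 p.416; Balaban1984PropagatorsII, (2.19) and p.226, Lemma 2.1 (2.61) p.234;
Balaban1988RG2Cluster, (2.5)–(2.7) pp.12–13, p.15; AizenmanWarzel2015, §10.3] -/
theorem exists_rawEntryLetters_toMatrix_GAY_recordV4_prodCfg_of_reg335_of_posDefTr
    (hG : G ≤ B7Prop2Explicit.unitaryUnits (Matrix (Fin N) (Fin N) ℂ))
    {U₀ : CfgY (Matrix (Fin N) (Fin N) ℂ) i} {c α₀ : ℝ} (hC0 : 0 ≤ c * (kGeo i).M * α₀) (hC1 : c * (kGeo i).M * α₀ * ((d : ℝ) + 1) ≤ 1 / 16)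
    (hreg : (bg9K (Matrix (Fin N) (Fin N) ℂ) G i).Reg335 c α₀ U₀)
    (η : ℝ) {Rc : ℝ} (hRc : 0 < Rc)
    -- module 79's numerals for the G′ factor (averaging support `D`, row sum `Cavg`, site reading `ℓ′` with `s`, torus-Lipschitz `κ`, fibre `m`) and its rate `ρ′`
    {D : ℕ}
    (hD : ∀ z w, avgCoeffY i z w ≠ 0 →
      Site.tdist ((boxEquiv i.hN).symm z) ((boxEquiv i.hN).symm (cornerY i (levY i z) z)) +
        Site.tdist ((boxEquiv i.hN).symm (cornerY i (levY i z) z)) ((boxEquiv i.hN).symm w) ≤ D)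
    {Cavg : ℝ} (hCavg0 : 0 ≤ Cavg) (hCavg : ∀ z, ∑ w, |avgCoeffY i z w| ≤ Cavg)
    (ℓ' : SiteY i → UT Nf) {s : ℝ} (hs0 : 0 ≤ s)
    (hℓ : ∀ μ z, tdist1 Nf (ℓ' (shiftY i μ z)) (ℓ' z) ≤ s) (hℓa : ∀ z w, avgCoeffY i z w ≠ 0 → tdist1 Nf (ℓ' z) (ℓ' w) ≤ s)
    {κr : ℝ} (hκ0 : 0 ≤ κr)
    (hκ : ∀ z w : SiteY i, κr * tdist1 Nf (ℓ' z) (ℓ' w) ≤ ((((ℓ + 1) ^ i.k : ℕ) : ℝ))⁻¹ * torusSupNorm (toKT i).NB (z.1 - w.1))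
    {m : ℕ} (hfib : ∀ y : UT Nf, (univ.filter fun p : SiteY i × (Fin N × Fin N) => ℓ' p.1 = y).card ≤ m)
    {ρ' : ℝ} (hρ'0 : 0 ≤ ρ') (hρ' : ρ' < (1 / (4 * ((d : ℝ) + 2))) * κr)
    -- the radius at which the chain is read: any `0 < R′ ≤ R₁⋆` (79's located thin radius, stated once)
    {R' : ℝ} (hR'0 : 0 < R')
    (hR' : R' ≤ Rc / (4 * ((1 * (((d : ℝ) + 1) *
          (1 * Real.exp (|η| * Rc) * (1 * Real.exp (|η| * Rc) * 1 * (1 * Real.exp (|η| * Rc)) + 1) * (1 * Real.exp (|η| * Rc)) +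
            (1 * Real.exp (|η| * Rc) * 1 * (1 * Real.exp (|η| * Rc)) + 1)) +
          Cavg * ((1 * Real.exp (|η| * Rc)) ^ D * 1 * (1 * Real.exp (|η| * Rc)) ^ D)) * Real.exp ((1 / (4 * ((d : ℝ) + 2)) * κr) * s)) *
          (1 * 1 * (16 * ((((ℓ + 1) ^ i.k : ℕ) : ℝ)) ^ 2 * Real.sqrt N)) *
          (m * B6.c0 1 (((1 / (4 * ((d : ℝ) + 2))) * κr - ρ') / 3) ^ ν) * (m * B6.c0 1 (((1 / (4 * ((d : ℝ) + 2))) * κr - ρ') / 3) ^ ν)) + 1))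
    -- the R-station's numerals (`Q′`-support `D_Q`, row ∕ column sums, block reading `ℓB` with range `r`)
    {DQ : ℕ}
    (hDQ : ∀ s z, qpK i s z ≠ 0 → Site.tdist ((boxEquiv i.hN).symm (blkCornerY i s)) ((boxEquiv i.hN).symm z) ≤ DQ)
    (hDQs : ∀ z s, qpsK i z s ≠ 0 → Site.tdist ((boxEquiv i.hN).symm (blkCornerY i s)) ((boxEquiv i.hN).symm z) ≤ DQ)
    {CQsr CQc : ℝ} (hCQsr0 : 0 ≤ CQsr) (hCQsr : ∀ z, ∑ s, |qpsK i z s| ≤ CQsr) (hCQc0 : 0 ≤ CQc) (hCQc : ∀ z, ∑ s, |qpK i s z| ≤ CQc)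
    (ℓB : BlkY i → UT Nf) {r : ℝ}
    (hℓQ : ∀ s z, qpK i s z ≠ 0 → tdist1 Nf (ℓB s) (ℓ' z) ≤ r) (hℓQs : ∀ z s, qpsK i z s ≠ 0 → tdist1 Nf (ℓ' z) (ℓB s) ≤ r)
    -- (a) the X⁻¹-junction's output at `(R′, ρ_X)`, `ρ_X ≤ ρ′`, and the R-station's rate loss `μ` with `2μ < ρ_X`
    {ρX BX μ : ℝ} (hρX0 : 0 ≤ ρX) (hρX : ρX ≤ ρ')
    (hXi : RawEntryLetters (fun a : Fin (d + 1) → Site (PV d ℓ i.m i.K hd hL) 0 → Matrix (Fin N) (Fin N) ℂ =>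
      LinearMap.toMatrix
        ((Pi.basis fun _ : BlkY i => Matrix.stdBasis ℂ (Fin N) (Fin N)).reindex (Equiv.sigmaEquivProd (BlkY i) (Fin N × Fin N)))
        ((Pi.basis fun _ : BlkY i => Matrix.stdBasis ℂ (Fin N) (Fin N)).reindex (Equiv.sigmaEquivProd (BlkY i) (Fin N × Fin N)))
        (XinvY i (parSymY i) (GpY i (parSymY i)) (prodCfg U₀ η a)))
      (fun p : BlkY i × (Fin N × Fin N) => ℓB p.1) R' ρX BX)
    (hμ : 0 < μ) (h2μ : 2 * μ < ρX)
    -- module 76's numerals for the local part `Δ(U) + Q*aQ(U)` and the bond reading `ℓF` with `s_F`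
    {c₁ c₂ : ℝ} (hc₀ : 0 ≤ c₁) (hc₂0 : 0 ≤ c₂) (hc₁ : ∀ p, ∑ b, |curlK i p b| ≤ c₁) (hc₂ : ∀ b, ∑ p, |cocurlK i b p| ≤ c₂)
    {Nb : ℝ} (hNb0 : 0 ≤ Nb)
    (hNb : ∀ b : FBondY i,
      ((((Finset.univ : Finset (PlaqY i)) ×ˢ (Finset.univ : Finset (Fin 4))).filter fun pm => edgeY i pm.1 pm.2 = b).card : ℝ) ≤ Nb)
    {Da : ℕ}
    (hDa : ∀ ι b, qK i ι b ≠ 0 → Site.tdist (embIter (ι.1.1 : ℕ) ι.1.2.src) b.src ≤ Da)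
    (hDa' : ∀ b ι, qsK i b ι ≠ 0 → Site.tdist (embIter (ι.1.1 : ℕ) ι.1.2.src) b.src ≤ Da)
    {cQ cQs ca : ℝ} (hcQ0 : 0 ≤ cQ) (hcQs0 : 0 ≤ cQs) (hca0 : 0 ≤ ca) (hcQ : ∀ ι, ∑ b, |qK i ι b| ≤ cQ) (hcQs : ∀ b, ∑ ι, |qsK i b ι| ≤ cQs)
    (hca : ∀ ι, ∑ ι', |aK i ι ι'| ≤ ca)
    (ℓF : FBondY i → UT Nf) {sF : ℝ}
    (hℓp : ∀ p m l, tdist1 Nf (ℓF (edgeY i p m)) (ℓF (edgeY i p l)) ≤ sF)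
    (hℓq : ∀ b ι ι' b', qsK i b ι ≠ 0 → aK i ι ι' ≠ 0 → qK i ι' b' ≠ 0 → tdist1 Nf (ℓF b) (ℓF b') ≤ sF)
    -- the G-station's `D ∕ D*` numerals, the site–bond reading range `r′`, a fibre bound of `ℓF`
    {CgR CdC : ℝ} (hCgR0 : 0 ≤ CgR) (hCgR : ∀ bb, ∑ z, |gradK i bb z| ≤ CgR) (hCdC0 : 0 ≤ CdC) (hCdC : ∀ bb, ∑ z, |divK i z bb| ≤ CdC)
    {r' : ℝ}
    (hℓG : ∀ bb z, gradK i bb z ≠ 0 → tdist1 Nf (ℓF bb) (ℓ' z) ≤ r') (hℓD : ∀ z bb, divK i z bb ≠ 0 → tdist1 Nf (ℓ' z) (ℓF bb) ≤ r')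
    {mF : ℕ} (hfibF : ∀ y : UT Nf, (univ.filter fun p : FBondY i × (Fin N × Fin N) => ℓF p.1 = y).card ≤ mF)
    -- (b) ROW 17's ONE CLAUSE at the one real background, in a weight `w > 0` with ratio numeral `Θ ≥ 0`
    (w : FBondY i → ℝ) (hw : ∀ s, 0 < w s) {Θ : ℝ} (hΘ0 : 0 ≤ Θ) (hΘ : ∀ s t : FBondY i, Real.sqrt (w s) ≤ Θ * Real.sqrt (w t))
    (hpd : PosDefTr w (deltaAY i (parSymY i) (parBY i) (GpY i (parSymY i)) U₀)) :
    ∃ κ : ℝ, 0 < κ ∧ ∃ BG : ℝ, 0 ≤ BG ∧ ∀ ρ'' : ℝ, 0 ≤ ρ'' → ρ'' < κ → ∃ R₁ : ℝ, 0 < R₁ ∧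
      RawEntryLetters (fun a : Fin (d + 1) → Site (PV d ℓ i.m i.K hd hL) 0 → Matrix (Fin N) (Fin N) ℂ =>
          LinearMap.toMatrix
            ((Pi.basis fun _ : FBondY i => Matrix.stdBasis ℂ (Fin N) (Fin N)).reindex (Equiv.sigmaEquivProd (FBondY i) (Fin N × Fin N)))
            ((Pi.basis fun _ : FBondY i => Matrix.stdBasis ℂ (Fin N) (Fin N)).reindex (Equiv.sigmaEquivProd (FBondY i) (Fin N × Fin N)))
            (GAY i (parSymY i) (parBY i) (GpY i (parSymY i)) (prodCfg U₀ η a)))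
        (fun p : FBondY i × (Fin N × Fin N) => ℓF p.1) R₁ ρ'' BG := by
  -- the pencil's size numeral `K₀ = 1`
  obtain ⟨hU, hUi⟩ := norm_unit_le_one_of_mem i hG hreg.1
  have hρR : 0 < ρX - 2 * μ := by linarith
  -- R along the pencil on (3.35): G′ by 79, R-station at v4 (`B13OpsYPencilRProjSym` §2, record coordinates)
  have hR := rawEntryLetters_toMatrix_RY_parSymY_prodCfg_of_reg335_record i hG hC0 hC1 hreg η hRc hD hCavg0 hCavg ℓ' hs0 hℓ hℓa hκ0 hκ hfib
    hρ'0 hρ' hR'0 hR' hDQ hDQs hCQsr0 hCQsr hCQc0 hCQc ℓB hℓQ hℓQs hρX0 hρX hXi hμ h2μ.le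
  -- the local part (76 §4) and Δ_a (the G-station's §3) along the pencil at radius `R′`, rate `ρ_X − 2μ`
  have hLoc := rawEntryLetters_toMatrix_localDeltaA_prodCfg i (Matrix.stdBasis ℂ (Fin N) (Fin N)) U₀ η hU hUi le_rfl hR'0.le hc₀ hc₂0 hc₁ hc₂ hNb0 hNb
    hDa hDa' hcQ0 hcQs0 hca0 hcQ hcQs hca (norm_stdBasis_repr_le) zero_le_one (norm_stdBasis_le_one) zero_le_one ℓF hℓp hℓq hρR.le
  have hA := rawEntryLetters_toMatrix_deltaAY_prodCfg i (Matrix.stdBasis ℂ (Fin N) (Fin N)) U₀ η (parSymY i) (parBY i) (GpY i (parSymY i)) hU hUi le_rfl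
    hR'0.le hCgR0 hCgR hCdC0 hCdC (norm_stdBasis_repr_le) zero_le_one (norm_stdBasis_le_one) zero_le_one ℓ' ℓF hℓG hℓD hρR.le hR hLoc
  -- the last inverse from row 17's clause (`B13GreenCentreDecayOfCoercive` §6)
  exact exists_rawEntryLetters_toMatrix_GAY_prodCfg_of_posDefTr i (parSymY i) (parBY i) (GpY i (parSymY i)) U₀ η hA hR'0 hρR w hw hΘ0 hΘ hpd hfibF

/-- ★★★★ **… IN ROW 17's OWN CURRENCY** (flat weight `w = 1`, `Θ = 1`): the N06-side input is LITERALLY `B9Thm311PosAtRecordV4` §5's one clause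
`PosDefTr (fun _ => 1) (deltaAY i (parSymY i) (parBY i) (GpY i (parSymY i)) U₀)` at the one real background `U₀ ∈ Reg335 c α₀`.
[cite: Balaban1985BackgroundPropagators, (3.26)–(3.27) p.395, (3.35) p.396, Thms 3.1–3.3 pp.397–399, Thm 3.4 p.400, (3.84)–(3.86) p.407, Thm 3.10 (3.108) p.416, Thm 3.11 p.416;
Balaban1984PropagatorsII, p.226; Balaban1988RG2Cluster, (2.5)–(2.7) pp.12–13] -/
theorem exists_rawEntryLetters_toMatrix_GAY_recordV4_prodCfg_of_reg335_of_posDefTr_one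
    (hG : G ≤ B7Prop2Explicit.unitaryUnits (Matrix (Fin N) (Fin N) ℂ))
    {U₀ : CfgY (Matrix (Fin N) (Fin N) ℂ) i} {c α₀ : ℝ} (hC0 : 0 ≤ c * (kGeo i).M * α₀) (hC1 : c * (kGeo i).M * α₀ * ((d : ℝ) + 1) ≤ 1 / 16)
    (hreg : (bg9K (Matrix (Fin N) (Fin N) ℂ) G i).Reg335 c α₀ U₀)
    (η : ℝ) {Rc : ℝ} (hRc : 0 < Rc)
    -- module 79's numerals for the G′ factor (averaging support `D`, row sum `Cavg`, site reading `ℓ′` with `s`, torus-Lipschitz `κ`, fibre `m`) and its rate `ρ′`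
    {D : ℕ}
    (hD : ∀ z w, avgCoeffY i z w ≠ 0 →
      Site.tdist ((boxEquiv i.hN).symm z) ((boxEquiv i.hN).symm (cornerY i (levY i z) z)) +
        Site.tdist ((boxEquiv i.hN).symm (cornerY i (levY i z) z)) ((boxEquiv i.hN).symm w) ≤ D)
    {Cavg : ℝ} (hCavg0 : 0 ≤ Cavg) (hCavg : ∀ z, ∑ w, |avgCoeffY i z w| ≤ Cavg)
    (ℓ' : SiteY i → UT Nf) {s : ℝ} (hs0 : 0 ≤ s)
    (hℓ : ∀ μ z, tdist1 Nf (ℓ' (shiftY i μ z)) (ℓ' z) ≤ s) (hℓa : ∀ z w, avgCoeffY i z w ≠ 0 → tdist1 Nf (ℓ' z) (ℓ' w) ≤ s)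
    {κr : ℝ} (hκ0 : 0 ≤ κr)
    (hκ : ∀ z w : SiteY i, κr * tdist1 Nf (ℓ' z) (ℓ' w) ≤ ((((ℓ + 1) ^ i.k : ℕ) : ℝ))⁻¹ * torusSupNorm (toKT i).NB (z.1 - w.1))
    {m : ℕ} (hfib : ∀ y : UT Nf, (univ.filter fun p : SiteY i × (Fin N × Fin N) => ℓ' p.1 = y).card ≤ m)
    {ρ' : ℝ} (hρ'0 : 0 ≤ ρ') (hρ' : ρ' < (1 / (4 * ((d : ℝ) + 2))) * κr)
    -- the radius at which the chain is read: any `0 < R′ ≤ R₁⋆` (79's located thin radius, stated once)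
    {R' : ℝ} (hR'0 : 0 < R')
    (hR' : R' ≤ Rc / (4 * ((1 * (((d : ℝ) + 1) *
          (1 * Real.exp (|η| * Rc) * (1 * Real.exp (|η| * Rc) * 1 * (1 * Real.exp (|η| * Rc)) + 1) * (1 * Real.exp (|η| * Rc)) +
            (1 * Real.exp (|η| * Rc) * 1 * (1 * Real.exp (|η| * Rc)) + 1)) +
          Cavg * ((1 * Real.exp (|η| * Rc)) ^ D * 1 * (1 * Real.exp (|η| * Rc)) ^ D)) * Real.exp ((1 / (4 * ((d : ℝ) + 2)) * κr) * s)) *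
          (1 * 1 * (16 * ((((ℓ + 1) ^ i.k : ℕ) : ℝ)) ^ 2 * Real.sqrt N)) *
          (m * B6.c0 1 (((1 / (4 * ((d : ℝ) + 2))) * κr - ρ') / 3) ^ ν) * (m * B6.c0 1 (((1 / (4 * ((d : ℝ) + 2))) * κr - ρ') / 3) ^ ν)) + 1))
    -- the R-station's numerals (`Q′`-support `D_Q`, row ∕ column sums, block reading `ℓB` with range `r`)
    {DQ : ℕ}
    (hDQ : ∀ s z, qpK i s z ≠ 0 → Site.tdist ((boxEquiv i.hN).symm (blkCornerY i s)) ((boxEquiv i.hN).symm z) ≤ DQ)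
    (hDQs : ∀ z s, qpsK i z s ≠ 0 → Site.tdist ((boxEquiv i.hN).symm (blkCornerY i s)) ((boxEquiv i.hN).symm z) ≤ DQ)
    {CQsr CQc : ℝ} (hCQsr0 : 0 ≤ CQsr) (hCQsr : ∀ z, ∑ s, |qpsK i z s| ≤ CQsr) (hCQc0 : 0 ≤ CQc) (hCQc : ∀ z, ∑ s, |qpK i s z| ≤ CQc)
    (ℓB : BlkY i → UT Nf) {r : ℝ}
    (hℓQ : ∀ s z, qpK i s z ≠ 0 → tdist1 Nf (ℓB s) (ℓ' z) ≤ r) (hℓQs : ∀ z s, qpsK i z s ≠ 0 → tdist1 Nf (ℓ' z) (ℓB s) ≤ r)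
    -- (a) the X⁻¹-junction's output at `(R′, ρ_X)`, `ρ_X ≤ ρ′`, and the R-station's rate loss `μ` with `2μ < ρ_X`
    {ρX BX μ : ℝ} (hρX0 : 0 ≤ ρX) (hρX : ρX ≤ ρ')
    (hXi : RawEntryLetters (fun a : Fin (d + 1) → Site (PV d ℓ i.m i.K hd hL) 0 → Matrix (Fin N) (Fin N) ℂ =>
      LinearMap.toMatrix
        ((Pi.basis fun _ : BlkY i => Matrix.stdBasis ℂ (Fin N) (Fin N)).reindex (Equiv.sigmaEquivProd (BlkY i) (Fin N × Fin N)))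
        ((Pi.basis fun _ : BlkY i => Matrix.stdBasis ℂ (Fin N) (Fin N)).reindex (Equiv.sigmaEquivProd (BlkY i) (Fin N × Fin N)))
        (XinvY i (parSymY i) (GpY i (parSymY i)) (prodCfg U₀ η a)))
      (fun p : BlkY i × (Fin N × Fin N) => ℓB p.1) R' ρX BX)
    (hμ : 0 < μ) (h2μ : 2 * μ < ρX)
    -- module 76's numerals for the local part `Δ(U) + Q*aQ(U)` and the bond reading `ℓF` with `s_F`
    {c₁ c₂ : ℝ} (hc₀ : 0 ≤ c₁) (hc₂0 : 0 ≤ c₂) (hc₁ : ∀ p, ∑ b, |curlK i p b| ≤ c₁) (hc₂ : ∀ b, ∑ p, |cocurlK i b p| ≤ c₂)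
    {Nb : ℝ} (hNb0 : 0 ≤ Nb)
    (hNb : ∀ b : FBondY i,
      ((((Finset.univ : Finset (PlaqY i)) ×ˢ (Finset.univ : Finset (Fin 4))).filter fun pm => edgeY i pm.1 pm.2 = b).card : ℝ) ≤ Nb)
    {Da : ℕ}
    (hDa : ∀ ι b, qK i ι b ≠ 0 → Site.tdist (embIter (ι.1.1 : ℕ) ι.1.2.src) b.src ≤ Da)
    (hDa' : ∀ b ι, qsK i b ι ≠ 0 → Site.tdist (embIter (ι.1.1 : ℕ) ι.1.2.src) b.src ≤ Da)
    {cQ cQs ca : ℝ} (hcQ0 : 0 ≤ cQ) (hcQs0 : 0 ≤ cQs) (hca0 : 0 ≤ ca) (hcQ : ∀ ι, ∑ b, |qK i ι b| ≤ cQ) (hcQs : ∀ b, ∑ ι, |qsK i b ι| ≤ cQs)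
    (hca : ∀ ι, ∑ ι', |aK i ι ι'| ≤ ca)
    (ℓF : FBondY i → UT Nf) {sF : ℝ}
    (hℓp : ∀ p m l, tdist1 Nf (ℓF (edgeY i p m)) (ℓF (edgeY i p l)) ≤ sF)
    (hℓq : ∀ b ι ι' b', qsK i b ι ≠ 0 → aK i ι ι' ≠ 0 → qK i ι' b' ≠ 0 → tdist1 Nf (ℓF b) (ℓF b') ≤ sF)
    -- the G-station's `D ∕ D*` numerals, the site–bond reading range `r′`, a fibre bound of `ℓF`
    {CgR CdC : ℝ} (hCgR0 : 0 ≤ CgR) (hCgR : ∀ bb, ∑ z, |gradK i bb z| ≤ CgR) (hCdC0 : 0 ≤ CdC) (hCdC : ∀ bb, ∑ z, |divK i z bb| ≤ CdC)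
    {r' : ℝ}
    (hℓG : ∀ bb z, gradK i bb z ≠ 0 → tdist1 Nf (ℓF bb) (ℓ' z) ≤ r') (hℓD : ∀ z bb, divK i z bb ≠ 0 → tdist1 Nf (ℓ' z) (ℓF bb) ≤ r')
    {mF : ℕ} (hfibF : ∀ y : UT Nf, (univ.filter fun p : FBondY i × (Fin N × Fin N) => ℓF p.1 = y).card ≤ mF)
    -- (b) ROW 17's ONE CLAUSE, verbatim
    (hpd : PosDefTr (fun _ => (1 : ℝ)) (deltaAY i (parSymY i) (parBY i) (GpY i (parSymY i)) U₀)) :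
    ∃ κ : ℝ, 0 < κ ∧ ∃ BG : ℝ, 0 ≤ BG ∧ ∀ ρ'' : ℝ, 0 ≤ ρ'' → ρ'' < κ → ∃ R₁ : ℝ, 0 < R₁ ∧
      RawEntryLetters (fun a : Fin (d + 1) → Site (PV d ℓ i.m i.K hd hL) 0 → Matrix (Fin N) (Fin N) ℂ =>
          LinearMap.toMatrix
            ((Pi.basis fun _ : FBondY i => Matrix.stdBasis ℂ (Fin N) (Fin N)).reindex (Equiv.sigmaEquivProd (FBondY i) (Fin N × Fin N)))
            ((Pi.basis fun _ : FBondY i => Matrix.stdBasis ℂ (Fin N) (Fin N)).reindex (Equiv.sigmaEquivProd (FBondY i) (Fin N × Fin N)))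
            (GAY i (parSymY i) (parBY i) (GpY i (parSymY i)) (prodCfg U₀ η a)))
        (fun p : FBondY i × (Fin N × Fin N) => ℓF p.1) R₁ ρ'' BG :=
  exists_rawEntryLetters_toMatrix_GAY_recordV4_prodCfg_of_reg335_of_posDefTr i hG hC0 hC1 hreg η hRc hD hCavg0 hCavg ℓ' hs0 hℓ hℓa hκ0 hκ hfib
    hρ'0 hρ' hR'0 hR' hDQ hDQs hCQsr0 hCQsr hCQc0 hCQc ℓB hℓQ hℓQs hρX0 hρX hXi hμ h2μ hc₀ hc₂0 hc₁ hc₂ hNb0 hNb hDa hDa' hcQ0 hcQs0 hca0 hcQ hcQs hca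
    ℓF hℓp hℓq hCgR0 hCgR hCdC0 hCdC hℓG hℓD hfibF (fun _ => (1 : ℝ)) (fun _ => one_pos) zero_le_one (fun _ _ => by rw [one_mul]) hpd

/-! ## §2. ★★★ A6 — THE WHOLE CHAIN AT THE UNIT BACKGROUND: no analytic hypothesis left -/

/-- ★★★ **A6 — THE v4 G-CHAIN IS JOINTLY INHABITED: AT `U₀ = 1` EVERY DISPLAYED ANALYTIC INPUT IS A TREE THEOREM.**  `U ≡ 1` lies in the class (3.35) for every `c, α₀ > 0`
(`B9BackgroundsKLevelV1.reg335_one`); the X⁻¹ knit on (3.35) is n10-w5's `B13XinvSymLettersOfReg335.rawEntryLetters_toMatrix_XinvY_parSymY_prodCfg_of_reg335` (Thm 3.2 via 81 ∕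
79 ∕ p613219, N06's theorems inside, NO N06 binder); row 17's one clause HOLDS at `U = 1` (dag-n06-j's `posDefTr_deltaAY_parSymY_one`).  Hence §1 gives, for every
admissible `c, α₀ > 0` with `c·M·α₀·(d+1) ≤ 1∕16`, every `η`, `0 < Rc`, every target rate `0 < ρ′ < δ₀κ` and NODE 00's dictionary numerals ∕ readings ONLY:
`∃ κ > 0, ∃ B_G ≥ 0, ∀ 0 ≤ ρ″ < κ, ∃ R₁ > 0, RawEntryLetters (A′ ↦ toMatrix B′ B′ (G(e^{iηA′}·1))) (ℓF ∘ fst) R₁ ρ″ B_G` — NODE 00's propagator `G = Δ_a⁻¹` at the v4 letters is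
analytic along pv27's pencil about the unit background with exponentially decaying matrix entries, with NO displayed analytic hypothesis: the binder architecture of
the chain `G′ → X⁻¹ → R → Δ_a → G` (79, XQuadGen, 81, p613219, p615136, RProjSym, 76, Green, GreenCentre, §1) is consistent end to end.  (The X⁻¹ rate `κ_X` and the
R-station's loss are chosen inside from n10-w5's smallness window by `exists_uniform_rate`; [4]'s flat-background theorems are the print counterpart.)
[cite: Balaban1984PropagatorsII, (2.19)–(2.22) p.226, Props 2.2–2.3 pp.234–238; Balaban1985BackgroundPropagators, Cor. 3.5 p.407 («U = 1»), Thm 3.4 p.400, Thm 3.11 p.416;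
Balaban1988RG2Cluster, (2.5)–(2.7) pp.12–13] -/
theorem exists_rawEntryLetters_toMatrix_GAY_recordV4_prodCfg_one
    (hG : G ≤ B7Prop2Explicit.unitaryUnits (Matrix (Fin N) (Fin N) ℂ))
    {c α₀ : ℝ} (hc : 0 < c) (hα : 0 < α₀) (hC1 : c * (kGeo i).M * α₀ * ((d : ℝ) + 1) ≤ 1 / 16)
    (η : ℝ) {Rc : ℝ} (hRc : 0 < Rc)
    -- module 79's numerals (G′ factor) and its target rate `0 < ρ′ < δ₀κ`
    {D : ℕ}
    (hD : ∀ z w, avgCoeffY i z w ≠ 0 →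
      Site.tdist ((boxEquiv i.hN).symm z) ((boxEquiv i.hN).symm (cornerY i (levY i z) z)) +
        Site.tdist ((boxEquiv i.hN).symm (cornerY i (levY i z) z)) ((boxEquiv i.hN).symm w) ≤ D)
    {Cavg : ℝ} (hCavg0 : 0 ≤ Cavg) (hCavg : ∀ z, ∑ w, |avgCoeffY i z w| ≤ Cavg)
    (ℓ' : SiteY i → UT Nf) {s : ℝ} (hs0 : 0 ≤ s)
    (hℓ : ∀ μ z, tdist1 Nf (ℓ' (shiftY i μ z)) (ℓ' z) ≤ s) (hℓa : ∀ z w, avgCoeffY i z w ≠ 0 → tdist1 Nf (ℓ' z) (ℓ' w) ≤ s)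
    {κr : ℝ} (hκ0 : 0 ≤ κr)
    (hκ : ∀ z w : SiteY i, κr * tdist1 Nf (ℓ' z) (ℓ' w) ≤ ((((ℓ + 1) ^ i.k : ℕ) : ℝ))⁻¹ * torusSupNorm (toKT i).NB (z.1 - w.1))
    {m : ℕ} (hfib : ∀ y : UT Nf, (univ.filter fun p : SiteY i × (Fin N × Fin N) => ℓ' p.1 = y).card ≤ m)
    {ρ' : ℝ} (hρ'0 : 0 < ρ') (hρ' : ρ' < (1 / (4 * ((d : ℝ) + 2))) * κr)
    -- the `Q′`-support numeral and the four kernel sums (the X⁻¹-junction's `CQ, CQs` and the R-station's `CQsr, CQc`), block reading `ℓB` with range `r` and fibre `m_B`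
    {DQ : ℕ}
    (hDQ : ∀ s z, qpK i s z ≠ 0 → Site.tdist ((boxEquiv i.hN).symm (blkCornerY i s)) ((boxEquiv i.hN).symm z) ≤ DQ)
    (hDQs : ∀ z s, qpsK i z s ≠ 0 → Site.tdist ((boxEquiv i.hN).symm (blkCornerY i s)) ((boxEquiv i.hN).symm z) ≤ DQ)
    {CQ CQs : ℝ} (hCQ0 : 0 ≤ CQ) (hCQ : ∀ s, ∑ z, |qpK i s z| ≤ CQ) (hCQs0 : 0 ≤ CQs) (hCQs : ∀ s, ∑ z, |qpsK i z s| ≤ CQs)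
    {CQsr CQc : ℝ} (hCQsr0 : 0 ≤ CQsr) (hCQsr : ∀ z, ∑ s, |qpsK i z s| ≤ CQsr) (hCQc0 : 0 ≤ CQc) (hCQc : ∀ z, ∑ s, |qpK i s z| ≤ CQc)
    (ℓB : BlkY i → UT Nf) {r : ℝ}
    (hℓQ : ∀ s z, qpK i s z ≠ 0 → tdist1 Nf (ℓB s) (ℓ' z) ≤ r) (hℓQs : ∀ z s, qpsK i z s ≠ 0 → tdist1 Nf (ℓ' z) (ℓB s) ≤ r)
    {mB : ℕ} (hfibB : ∀ y : UT Nf, (univ.filter fun p : BlkY i × (Fin N × Fin N) => ℓB p.1 = y).card ≤ mB)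
    -- module 76's numerals (local part) and the bond reading `ℓF` with `s_F`
    {c₁ c₂ : ℝ} (hc₀ : 0 ≤ c₁) (hc₂0 : 0 ≤ c₂) (hc₁ : ∀ p, ∑ b, |curlK i p b| ≤ c₁) (hc₂ : ∀ b, ∑ p, |cocurlK i b p| ≤ c₂)
    {Nb : ℝ} (hNb0 : 0 ≤ Nb)
    (hNb : ∀ b : FBondY i,
      ((((Finset.univ : Finset (PlaqY i)) ×ˢ (Finset.univ : Finset (Fin 4))).filter fun pm => edgeY i pm.1 pm.2 = b).card : ℝ) ≤ Nb)
    {Da : ℕ}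
    (hDa : ∀ ι b, qK i ι b ≠ 0 → Site.tdist (embIter (ι.1.1 : ℕ) ι.1.2.src) b.src ≤ Da)
    (hDa' : ∀ b ι, qsK i b ι ≠ 0 → Site.tdist (embIter (ι.1.1 : ℕ) ι.1.2.src) b.src ≤ Da)
    {cQ cQs ca : ℝ} (hcQ0 : 0 ≤ cQ) (hcQs0 : 0 ≤ cQs) (hca0 : 0 ≤ ca) (hcQ : ∀ ι, ∑ b, |qK i ι b| ≤ cQ) (hcQs : ∀ b, ∑ ι, |qsK i b ι| ≤ cQs)
    (hca : ∀ ι, ∑ ι', |aK i ι ι'| ≤ ca)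
    (ℓF : FBondY i → UT Nf) {sF : ℝ}
    (hℓp : ∀ p m l, tdist1 Nf (ℓF (edgeY i p m)) (ℓF (edgeY i p l)) ≤ sF)
    (hℓq : ∀ b ι ι' b', qsK i b ι ≠ 0 → aK i ι ι' ≠ 0 → qK i ι' b' ≠ 0 → tdist1 Nf (ℓF b) (ℓF b') ≤ sF)
    -- the G-station's numerals and the bond fibre bound
    {CgR CdC : ℝ} (hCgR0 : 0 ≤ CgR) (hCgR : ∀ bb, ∑ z, |gradK i bb z| ≤ CgR) (hCdC0 : 0 ≤ CdC) (hCdC : ∀ bb, ∑ z, |divK i z bb| ≤ CdC)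
    {r' : ℝ}
    (hℓG : ∀ bb z, gradK i bb z ≠ 0 → tdist1 Nf (ℓF bb) (ℓ' z) ≤ r') (hℓD : ∀ z bb, divK i z bb ≠ 0 → tdist1 Nf (ℓ' z) (ℓF bb) ≤ r')
    {mF : ℕ} (hfibF : ∀ y : UT Nf, (univ.filter fun p : FBondY i × (Fin N × Fin N) => ℓF p.1 = y).card ≤ mF) :
    ∃ κ : ℝ, 0 < κ ∧ ∃ BG : ℝ, 0 ≤ BG ∧ ∀ ρ'' : ℝ, 0 ≤ ρ'' → ρ'' < κ → ∃ R₁ : ℝ, 0 < R₁ ∧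
      RawEntryLetters (fun a : Fin (d + 1) → Site (PV d ℓ i.m i.K hd hL) 0 → Matrix (Fin N) (Fin N) ℂ =>
          LinearMap.toMatrix
            ((Pi.basis fun _ : FBondY i => Matrix.stdBasis ℂ (Fin N) (Fin N)).reindex (Equiv.sigmaEquivProd (FBondY i) (Fin N × Fin N)))
            ((Pi.basis fun _ : FBondY i => Matrix.stdBasis ℂ (Fin N) (Fin N)).reindex (Equiv.sigmaEquivProd (FBondY i) (Fin N × Fin N)))
            (GAY i (parSymY i) (parBY i) (GpY i (parSymY i))
              (prodCfg ((bg9K (Matrix (Fin N) (Fin N) ℂ) G i).one) η a)))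
        (fun p : FBondY i × (Fin N × Fin N) => ℓF p.1) R₁ ρ'' BG := by
  -- `U ≡ 1` is in the class (3.35); `0 ≤ c·M·α₀`
  have hreg := reg335_one (𝔸 := Matrix (Fin N) (Fin N) ℂ) (G := G) i hc hα
  obtain ⟨-, -, hM⟩ := eta_pos_L_one_le_M_pos i
  have hC0 : 0 ≤ c * (kGeo i).M * α₀ := (mul_pos (mul_pos hc hM) hα).le
  -- the X⁻¹ knit's smallness window (n10-w5): loss `μ := ρ′∕2`, a rate `κ_X > 0` by `exists_uniform_rate`
  have hμ : 0 < ρ' / 2 := half_pos hρ'0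
  have hμρ : ρ' / 2 < ρ' := half_lt_self hρ'0
  have hBG0 : 0 ≤ 2 * (1 * 1 * (16 * ((((ℓ + 1) ^ i.k : ℕ) : ℝ)) ^ 2 * Real.sqrt N)) := by positivity
  have hKQ0 : 0 ≤ 1 * ((1 * Real.exp (|η| * Rc)) ^ DQ * 1 * (1 * Real.exp (|η| * Rc)) ^ DQ) := by positivity
  have ha0 : 0 ≤ Real.sqrt ((((ℓ : ℝ) + 1) ^ i.k) ^ (d + 1)) *
        (CQ * (Fintype.card (Fin N × Fin N) : ℝ) * (1 * ((1 * Real.exp (|η| * Rc)) ^ DQ * 1 * (1 * Real.exp (|η| * Rc)) ^ DQ)) *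
          (CQs * (Fintype.card (Fin N × Fin N) : ℝ) * (1 * ((1 * Real.exp (|η| * Rc)) ^ DQ * 1 * (1 * Real.exp (|η| * Rc)) ^ DQ))) *
          ((2 * (1 * 1 * (16 * ((((ℓ + 1) ^ i.k : ℕ) : ℝ)) ^ 2 * Real.sqrt N))) * (2 * (1 * 1 * (16 * ((((ℓ + 1) ^ i.k : ℕ) : ℝ)) ^ 2 * Real.sqrt N))) *
            (m * B6.c0 1 (ρ' / 2) ^ ν)) * Real.exp (2 * (ρ' - ρ' / 2) * r)) :=
    mul_nonneg (Real.sqrt_nonneg _)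
      (mul_nonneg
        (mul_nonneg
          (mul_nonneg (mul_nonneg (mul_nonneg hCQ0 (Nat.cast_nonneg _)) hKQ0) (mul_nonneg (mul_nonneg hCQs0 (Nat.cast_nonneg _)) hKQ0))
          (mul_nonneg (mul_nonneg hBG0 hBG0) (mul_nonneg (Nat.cast_nonneg _) (pow_nonneg (c0_nonneg _ _) _))))
        (Real.exp_pos _).le)
  have hV0 : 0 ≤ (mB : ℝ) * B6.c0 1 ((ρ' - ρ' / 2) / 2) ^ ν := mul_nonneg (Nat.cast_nonneg _) (pow_nonneg (c0_nonneg _ _) _)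
  have hm0 : (0 : ℝ) < ((4 * ((d : ℝ) + 1) + 1) ^ 2)⁻¹ := by positivity
  obtain ⟨κX, hκX0, hκX4, hκXm⟩ := exists_uniform_rate (m := ((4 * ((d : ℝ) + 1) + 1) ^ 2)⁻¹) (κ₀ := ρ' - ρ' / 2) hm0 (by linarith) ha0 hV0
  -- X⁻¹ along the pencil on (3.35) at `U₀ = 1` (n10-w5's knit), at the rate `κ_X ∕ 2 < κ_X`
  obtain ⟨R₁, hR₁0, -, hXi⟩ := rawEntryLetters_toMatrix_XinvY_parSymY_prodCfg_of_reg335 i hG hC0 hC1 hreg η hRc hD hCavg0 hCavg hDQ hDQs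
    hCQ0 hCQ hCQs0 hCQs ℓ' ℓB hs0 hℓ hℓa hκ0 hκ hℓQ hℓQs hfib hfibB hρ'0.le hρ' hμ hμρ hκX0.le hκX4 hκXm (half_pos hκX0).le (half_lt_self hκX0)
  -- the radius: the smaller of n10-w5's `R₁` and module 79's located thin radius `R⋆`
  have hT : 0 ≤ (1 * (((d : ℝ) + 1) *
          (1 * Real.exp (|η| * Rc) * (1 * Real.exp (|η| * Rc) * 1 * (1 * Real.exp (|η| * Rc)) + 1) * (1 * Real.exp (|η| * Rc)) +
            (1 * Real.exp (|η| * Rc) * 1 * (1 * Real.exp (|η| * Rc)) + 1)) +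
          Cavg * ((1 * Real.exp (|η| * Rc)) ^ D * 1 * (1 * Real.exp (|η| * Rc)) ^ D)) * Real.exp ((1 / (4 * ((d : ℝ) + 2)) * κr) * s)) *
          (1 * 1 * (16 * ((((ℓ + 1) ^ i.k : ℕ) : ℝ)) ^ 2 * Real.sqrt N)) *
          (m * B6.c0 1 (((1 / (4 * ((d : ℝ) + 2))) * κr - ρ') / 3) ^ ν) * (m * B6.c0 1 (((1 / (4 * ((d : ℝ) + 2))) * κr - ρ') / 3) ^ ν) :=
    mul_nonneg (mul_nonneg (mul_nonneg
      (mul_nonneg (mul_nonneg zero_le_one (add_nonneg (by positivity) (mul_nonneg hCavg0 (by positivity)))) (Real.exp_pos _).le)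
      (by positivity)) (mul_nonneg (Nat.cast_nonneg _) (pow_nonneg (c0_nonneg 1 _) ν)))
      (mul_nonneg (Nat.cast_nonneg _) (pow_nonneg (c0_nonneg 1 _) ν))
  have hRst := thinRadius_pos hRc hT
  -- row 17's one clause HOLDS at `U = 1` (dag-n06-j)
  have hpd : PosDefTr (fun _ => (1 : ℝ))
      (deltaAY i (parSymY i) (parBY i) (GpY i (parSymY i)) ((bg9K (Matrix (Fin N) (Fin N) ℂ) G i).one)) :=
    posDefTr_deltaAY_parSymY_one i
  -- §1 in row 17's currency at `U₀ = 1`, X⁻¹ rate `κ_X∕2`, R-loss `κ_X∕8`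
  exact exists_rawEntryLetters_toMatrix_GAY_recordV4_prodCfg_of_reg335_of_posDefTr_one i hG hC0 hC1 hreg η hRc hD hCavg0 hCavg ℓ' hs0 hℓ hℓa hκ0 hκ
    hfib hρ'0.le hρ' (lt_min hR₁0 hRst) (min_le_right _ _) hDQ hDQs hCQsr0 hCQsr hCQc0 hCQc ℓB hℓQ hℓQs (half_pos hκX0).le (by linarith)
    (rawEntryLetters_mono hXi (min_le_left _ _) le_rfl le_rfl) (by positivity : (0 : ℝ) < κX / 8) (by linarith) hc₀ hc₂0 hc₁ hc₂ hNb0 hNb hDa hDa' hcQ0 hcQs0 hca0 hcQ hcQs hca ℓF hℓp hℓq hCgR0 hCgR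
    hCdC0 hCdC hℓG hℓD hfibF hpd

end Chain

end Literature.MathematicalPhysics.QuantumFieldTheory.Balaban1983to89.B13GreenSymLettersOfReg335

end
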